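import Summits.QuantumFields.YangMills.Theorems.BalabanUVNodesN08HaarCompatibilityGuardWindowInjective
import Literature.NumberTheory.Automorphic.IwasawaDecompositionArchimedean

/-!
# BalabanUVNodes ∕ N08 — A UNIFORM WINDOW RADIUS (part 6): the tangent map of the printed fibre map is UNIFORMLY continuous in the base
# point AND the frozen holonomies on the closed guard, so ONE radius `r(ε)` serves every fibre — the window count of (E4) is uniform in `(h, W)`

WIDTH SEAT `pub-ymgap-dag-n08-w6` g4 (R399 (3a) second wave; CLAIM-5 ∕ INTENT-6 of record on HOME INBOX; successor of parts 1–5 p616149 · p617624 ·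
p619392 · p620432 · p621515 (+ parts 4∕5)), 2026-08-28.  Track A, DAG node N08 = [Balaban1985UV3] Thm 1 p. 257 (compact) + Thm 2 p. 272; key item K1⁷
`StabilityBAtRecordR13SepCoPH` (stmt-QuantumFields-20542), `--supports … --as helper`.  COUNT-NEUTRAL.

THE POINT.  (H_K-core) (sibling n08-w3's p620199) asks ONE constant `K` for ALL frozen families `V : Idx → G` and all coarse bonds; part 4
(`…GuardWindowInjective`) gives injectivity windows around each guarded point from the singular-value floor and the CONTINUITY of the tangent map, but
pointwise continuity yields a radius depending on the fibre `(h, W)`.  Since the closed guard `{(h, W) : hᵢ, W ∈ U(N), ‖hᵢW* − 1‖ ≤ δ₀}` (`δ₀ < 1∕2`) is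
COMPACT (the tree's `Matrix.isCompact_unitaryGroup`, Tychonoff) and `(h, W) ↦ emlD h c W` is JOINTLY continuous on the open domain (route
ReplicaVarianceTilt's `HeightChiSqLEmlDContinuous.continuousOn_emlD`), Heine–Cantor gives ONE radius:
* `isCompact_closedGuard`; `norm_guard_le_add` (`‖h·W′* − 1‖ ≤ ‖h·W* − 1‖ + ‖h‖·‖W′ − W‖`);
* ★★ `uniform_emlD_modulus`: for every `ε > 0` ONE `r > 0` such that for ALL unitaries `hᵢ, W` with `‖hᵢW* − 1‖ ≤ δ₀` and every matrix `W′` with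
  `‖W′ − W‖ < r`: the guard `‖hᵢW′* − 1‖ < 1∕2` holds and `‖emlD h c W′ − emlD h c W‖ ≤ ε` (operator norm);
* ★ `uniform_window`: the same in the window form part 4's `injOn_of_norm_fderiv_sub_le` consumes (`HasFDerivAt (Kmat h c) (emlD h c W′) W′` on the ball and
  the oscillation bound), uniformly in the fibre — so with `ε < 1 − Σcᵢ` (the floor, p612264) every `r`-ball is an injectivity window of the fibre map
  up to the chart distortion, and the number of windows needed to cover a fibre depends on `r = r(ε)` and `N` only.

HONEST FRAMING.  Count-neutral [folklore] compactness bookkeeping over pub-balaban's `Kmat`∕`emlD` and the cited joint continuity; NO chart composition, NO explicit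
radius, NO window count, NO density bound typed; (H_K)∕(H_K-core) NOT discharged; nothing of Bałaban asserted; E6′ NOT decided; `hmass` NOT supplied; N08 NOT
discharged; counts unmoved (typed 28∕28 · discharged 5∕27); no summit statement is proved by this seat — one finite 𝕋⁴ programme at fixed ε, R4 closes the
CONDITIONAL rung `BalabanLadder.UV` only; the Yang–Mills mass gap (Clay) is NOT proved by any of this; nothing continuum ∕ ℝ⁴ ∕ OS.  0 `sorry`, 0 `def`,
0 `instance`, 0 `notation`, standard axioms.
-/

noncomputable section

open Set NormedSpace Filter Metric
open scoped Topology Matrix Matrix.Norms.L2Operator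

namespace Summit.QuantumFields.YangMills.BalabanUVNodes.N08HaarCompatibilityGuardUniformWindow

open Literature.MathematicalPhysics.QuantumFieldTheory.Balaban1983to89
open Literature.MathematicalPhysics.QuantumFieldTheory.Balaban1983to89.T4EMLTangentInjective
open Summit.QuantumFields.YangMills.Theorems.HeightChiSqLEmlDContinuous (isOpen_emlDomain analyticOnNhd_Kmat continuousOn_emlD)
open Matrix (unitaryGroup)

variable {m : Type*} [Fintype m] [DecidableEq m] [Nonempty m] {ι : Type*} [Fintype ι]

omit [Nonempty m] [Fintype ι] in
/-- **The closed `δ₀`-guard over unitaries is compact**: `{(h, W) | hᵢ, W ∈ U(N), ‖hᵢ W* − 1‖ ≤ δ₀}` is a closed subset of the compact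
`U(N)^ι × U(N)` (the tree's `Matrix.isCompact_unitaryGroup`, Tychonoff). [folklore] -/
theorem isCompact_closedGuard (δ₀ : ℝ) :
    IsCompact {p : (ι → Matrix m m ℂ) × Matrix m m ℂ |
      (∀ i, p.1 i ∈ unitaryGroup m ℂ) ∧ p.2 ∈ unitaryGroup m ℂ ∧ ∀ i, ‖p.1 i * star p.2 - 1‖ ≤ δ₀} := by
  have hK : IsCompact ((Set.univ.pi fun _ : ι => (unitaryGroup m ℂ : Set (Matrix m m ℂ))) ×ˢ
      (unitaryGroup m ℂ : Set (Matrix m m ℂ))) :=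
    (isCompact_univ_pi fun _ => Literature.NumberTheory.Automorphic.Matrix.isCompact_unitaryGroup).prod Literature.NumberTheory.Automorphic.Matrix.isCompact_unitaryGroup
  have hC : IsClosed {p : (ι → Matrix m m ℂ) × Matrix m m ℂ | ∀ i, ‖p.1 i * star p.2 - 1‖ ≤ δ₀} := by
    rw [Set.setOf_forall]
    refine isClosed_iInter fun i => ?_
    have hc : Continuous fun p : (ι → Matrix m m ℂ) × Matrix m m ℂ => ‖p.1 i * star p.2 - 1‖ :=
      ((((continuous_apply i).comp continuous_fst).mul (continuous_star.comp continuous_snd)).sub continuous_const).norm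
    exact isClosed_le hc continuous_const
  have hA : IsClosed {p : (ι → Matrix m m ℂ) × Matrix m m ℂ | ∀ i, p.1 i ∈ unitaryGroup m ℂ} := by
    rw [Set.setOf_forall]
    exact isClosed_iInter fun i => isClosed_unitary.preimage ((continuous_apply i).comp continuous_fst)
  have hB : IsClosed {p : (ι → Matrix m m ℂ) × Matrix m m ℂ | p.2 ∈ unitaryGroup m ℂ} := isClosed_unitary.preimage continuous_snd
  have hset : {p : (ι → Matrix m m ℂ) × Matrix m m ℂ |
      (∀ i, p.1 i ∈ unitaryGroup m ℂ) ∧ p.2 ∈ unitaryGroup m ℂ ∧ ∀ i, ‖p.1 i * star p.2 - 1‖ ≤ δ₀}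
      = {p | ∀ i, p.1 i ∈ unitaryGroup m ℂ} ∩ ({p | p.2 ∈ unitaryGroup m ℂ} ∩ {p | ∀ i, ‖p.1 i * star p.2 - 1‖ ≤ δ₀}) := by
    ext p; simp only [Set.mem_inter_iff, Set.mem_setOf_eq]
  rw [hset]
  refine hK.of_isClosed_subset (hA.inter (hB.inter hC)) ?_
  rintro p ⟨h1, h2, -⟩
  exact ⟨Set.mem_univ_pi.2 fun i => h1 i, h2⟩

omit [Nonempty m] in
/-- Moving the base point moves the guard quantity by at most the displacement: `‖h·W′* − 1‖ ≤ ‖h·W* − 1‖ + ‖h‖·‖W′ − W‖`. [folklore] -/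
theorem norm_guard_le_add (h W W' : Matrix m m ℂ) :
    ‖h * star W' - 1‖ ≤ ‖h * star W - 1‖ + ‖h‖ * ‖W' - W‖ := by
  have e : h * star W' - 1 = (h * star W - 1) + h * star (W' - W) := by rw [star_sub]; noncomm_ring
  rw [e]
  refine (norm_add_le _ _).trans ?_
  have h2 : ‖h * star (W' - W)‖ ≤ ‖h‖ * ‖W' - W‖ := by
    refine (norm_mul_le _ _).trans ?_; rw [norm_star]
  linarith

/-- ★★ **UNIFORM CONTINUITY OF THE TANGENT MAP ON THE CLOSED GUARD.**  For weights `c` and any `δ₀ < 1∕2`, for every `ε > 0` there is ONE `r > 0` such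
that for ALL unitaries `hᵢ, W` with `‖hᵢW* − 1‖ ≤ δ₀` and every matrix `W′` with `‖W′ − W‖ < r`: the guard `‖hᵢW′* − 1‖ < 1∕2` still holds and
`‖D K_{W′} − D K_W‖ ≤ ε` (`D K = emlD h c`, operator norm) — the JOINT continuity of `(h, W) ↦ emlD h c W` (route ReplicaVarianceTilt's
`continuousOn_emlD`) is uniform on the compact closed guard (Heine–Cantor). [folklore] -/
theorem uniform_emlD_modulus (c : ι → ℝ) {δ₀ : ℝ} (hδ₀ : δ₀ < 1 / 2) {ε : ℝ} (hε : 0 < ε) :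
    ∃ r > 0, ∀ (h : ι → Matrix m m ℂ) (W W' : Matrix m m ℂ), (∀ i, h i ∈ unitaryGroup m ℂ) → W ∈ unitaryGroup m ℂ →
      (∀ i, ‖h i * star W - 1‖ ≤ δ₀) → ‖W' - W‖ < r →
        (∀ i, ‖h i * star W' - 1‖ < 1 / 2) ∧ ‖emlD h c W' - emlD h c W‖ ≤ ε := by
  -- the compact set `K`: unitary `h`, `W'` in the closed ball of radius 2, guard quantity `≤ δ₁ := (δ₀ + 1/2)/2`
  set δ₁ : ℝ := (δ₀ + 1 / 2) / 2 with hδ₁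
  have hδ₁' : δ₁ < 1 / 2 := by rw [hδ₁]; linarith
  set K : Set ((ι → Matrix m m ℂ) × Matrix m m ℂ) := {p | (∀ i, p.1 i ∈ unitaryGroup m ℂ) ∧ p.2 ∈ closedBall (0 : Matrix m m ℂ) 2 ∧
      ∀ i, ‖p.1 i * star p.2 - 1‖ ≤ δ₁} with hKdef
  have hKc : IsCompact K := by
    have hB : IsCompact ((Set.univ.pi fun _ : ι => (unitaryGroup m ℂ : Set (Matrix m m ℂ))) ×ˢ closedBall (0 : Matrix m m ℂ) 2) :=
      (isCompact_univ_pi fun _ => Literature.NumberTheory.Automorphic.Matrix.isCompact_unitaryGroup).prod (isCompact_closedBall _ _)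
    have hC : IsClosed {p : (ι → Matrix m m ℂ) × Matrix m m ℂ | ∀ i, ‖p.1 i * star p.2 - 1‖ ≤ δ₁} := by
      rw [Set.setOf_forall]
      refine isClosed_iInter fun i => ?_
      have hc : Continuous fun p : (ι → Matrix m m ℂ) × Matrix m m ℂ => ‖p.1 i * star p.2 - 1‖ :=
        ((((continuous_apply i).comp continuous_fst).mul (continuous_star.comp continuous_snd)).sub continuous_const).norm
      exact isClosed_le hc continuous_const
    have hA : IsClosed {p : (ι → Matrix m m ℂ) × Matrix m m ℂ | ∀ i, p.1 i ∈ unitaryGroup m ℂ} := by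
      rw [Set.setOf_forall]
      exact isClosed_iInter fun i => isClosed_unitary.preimage ((continuous_apply i).comp continuous_fst)
    have hB' : IsClosed {p : (ι → Matrix m m ℂ) × Matrix m m ℂ | p.2 ∈ closedBall (0 : Matrix m m ℂ) 2} :=
      isClosed_closedBall.preimage continuous_snd
    have hset : K = {p | ∀ i, p.1 i ∈ unitaryGroup m ℂ} ∩ ({p | p.2 ∈ closedBall (0 : Matrix m m ℂ) 2} ∩
        {p | ∀ i, ‖p.1 i * star p.2 - 1‖ ≤ δ₁}) := by
      ext p; simp only [hKdef, Set.mem_inter_iff, Set.mem_setOf_eq]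
    rw [hset]
    refine hB.of_isClosed_subset (hA.inter (hB'.inter hC)) ?_
    rintro p ⟨h1, h2, -⟩
    exact ⟨Set.mem_univ_pi.2 fun i => h1 i, h2⟩
  -- `K` lies in the open domain, where `emlD` is jointly continuous
  have hKdom : K ⊆ {p : (ι → Matrix m m ℂ) × Matrix m m ℂ | ∀ i, ‖p.1 i * star p.2 - 1‖ < 1} := fun p hp i =>
    (hp.2.2 i).trans_lt (by linarith)
  have hcont : ContinuousOn (fun p : (ι → Matrix m m ℂ) × Matrix m m ℂ => emlD p.1 c p.2) K := (continuousOn_emlD (m := m) c).mono hKdom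
  have huc := hKc.uniformContinuousOn_of_continuous hcont
  obtain ⟨η, hη, hηε⟩ := (Metric.uniformContinuousOn_iff (α := (ι → Matrix m m ℂ) × Matrix m m ℂ)
    (β := Matrix m m ℂ →L[ℝ] Matrix m m ℂ)).1 huc ε hε
  refine ⟨min η (min 1 (δ₁ - δ₀)), lt_min hη (lt_min one_pos (by rw [hδ₁]; linarith)), ?_⟩
  intro h W W' hh hW hg hr
  have hrη : ‖W' - W‖ < η := hr.trans_le (min_le_left _ _)
  have hr1 : ‖W' - W‖ < 1 := hr.trans_le ((min_le_right _ _).trans (min_le_left _ _))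
  have hrδ : ‖W' - W‖ < δ₁ - δ₀ := hr.trans_le ((min_le_right _ _).trans (min_le_right _ _))
  have hnh : ∀ i, ‖h i‖ = 1 := fun i => CStarRing.norm_of_mem_unitary (hh i)
  have hnW : ‖W‖ = 1 := CStarRing.norm_of_mem_unitary hW
  -- guard at `W'`
  have hg' : ∀ i, ‖h i * star W' - 1‖ ≤ δ₁ := fun i => by
    have := norm_guard_le_add (h i) W W'
    rw [hnh i, one_mul] at this
    linarith [hg i]
  have hW'2 : W' ∈ closedBall (0 : Matrix m m ℂ) 2 := by
    rw [mem_closedBall, dist_zero_right]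
    have : ‖W'‖ ≤ ‖W' - W‖ + ‖W‖ := norm_le_norm_sub_add W' W
    linarith
  have hW2 : W ∈ closedBall (0 : Matrix m m ℂ) 2 := by
    rw [mem_closedBall, dist_zero_right, hnW]; norm_num
  have hpK : ((h, W) : (ι → Matrix m m ℂ) × Matrix m m ℂ) ∈ K := ⟨hh, hW2, fun i => (hg i).trans (by rw [hδ₁]; linarith)⟩
  have hqK : ((h, W') : (ι → Matrix m m ℂ) × Matrix m m ℂ) ∈ K := ⟨hh, hW'2, hg'⟩
  refine ⟨fun i => (hg' i).trans_lt hδ₁', ?_⟩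
  have hd : dist ((h, W') : (ι → Matrix m m ℂ) × Matrix m m ℂ) (h, W) < η := by
    rw [Prod.dist_eq, dist_self, dist_eq_norm]
    exact max_lt_iff.2 ⟨hη, hrη⟩
  have hlt := hηε _ hqK _ hpK hd
  -- the `dist` of the uniformity-replaced pseudo-metric structure on `𝕄 →L[ℝ] 𝕄` IS the operator-norm distance (definitionally)
  have hlt' : ‖emlD h c W' - emlD h c W‖ < ε := by
    convert hlt using 1
    exact (dist_eq_norm (emlD h c W') (emlD h c W)).symm
  exact hlt'.le

/-- ★ **ONE RADIUS FOR ALL FIBRES, in window form**: with `r = r(ε)` of `uniform_emlD_modulus`, at EVERY guarded fibre `(h, W)` (unitaries,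
`‖hᵢW* − 1‖ ≤ δ₀`) the derivative of `Kmat h c` oscillates by at most `ε` over the ball `B(W, r)` — the hypothesis of part 4's
`injOn_of_norm_fderiv_sub_le` with `L = D K_W`, uniformly in the fibre. [folklore] -/
theorem uniform_window (c : ι → ℝ) {δ₀ : ℝ} (hδ₀ : δ₀ < 1 / 2) {ε : ℝ} (hε : 0 < ε) :
    ∃ r > 0, ∀ (h : ι → Matrix m m ℂ) (W : Matrix m m ℂ), (∀ i, h i ∈ unitaryGroup m ℂ) → W ∈ unitaryGroup m ℂ →
      (∀ i, ‖h i * star W - 1‖ ≤ δ₀) →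
        ∀ W' ∈ ball W r, HasFDerivAt (Kmat h c) (emlD h c W') W' ∧ ‖emlD h c W' - emlD h c W‖ ≤ ε := by
  obtain ⟨r, hr, H⟩ := uniform_emlD_modulus (m := m) c hδ₀ hε
  refine ⟨r, hr, fun h W hh hW hg W' hW' => ?_⟩
  have hd : ‖W' - W‖ < r := by rwa [mem_ball, dist_eq_norm] at hW'
  obtain ⟨hguard, hε'⟩ := H h W W' hh hW hg hd
  exact ⟨(hasStrictFDerivAt_Kmat h c fun i => (hguard i).trans (by norm_num)).hasFDerivAt, hε'⟩

end Summit.QuantumFields.YangMills.BalabanUVNodes.N08HaarCompatibilityGuardUniformWindow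

end
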